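import Summits.AtomisticToContinuum.BoseEinsteinCondensation.Theses.BECStronglyRayleigh
import Summits.AtomisticToContinuum.BoseEinsteinCondensation.Theorems.InsertionFieldDelocalisation.Negative.Toolkit
import Summits.AtomisticToContinuum.BoseEinsteinCondensation.Theorems.InsertionFieldDelocalisation.Negative.Tightness
import Summits.AtomisticToContinuum.BoseEinsteinCondensation.Theorems.BECStronglyRayleighInsertionFieldDelocalisationPoAveragingDecomposition
import Summits.AtomisticToContinuum.BoseEinsteinCondensation.Theorems.BECStronglyRayleighInsertionFieldDelocalisationPoAveragingFloors
import HarnessLib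

/-!
# PO averaging, deterministic part III: the stub `stub_poAveraging` REDUCED to its two bets
# (tilt and parallelism), kernel-checked
# (helper for stub `stub_poAveraging` of line `cosh-budget-penrose-onsager`, crux
# `BECStronglyRayleigh.InsertionFieldDelocalisation`, stmt-AtomisticToContinuum-9673)

With the exact mixture decompositions (`…PoAveragingDecomposition`) the insertion fields of the
Penrose–Onsager vector `Φ = A†ψ'` at level `N + 1` are positive mixtures
`r^T[Φ] = f_T + g_T + Σ_{z∈T} w_{T,z}` (`|T| = N - 1`; `f_T = U'_T·1_{Tᶜ}` flat,
`g_T = (L³ - 2N)·u'^T`, `w_{T,z} = r'^{T∖z}·1_{Tᶜ}`) and `u^T[Φ] = c_T + Σ_{z∈T} v_{T,z}` (`|T| = N`;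
`c_T = Re ψ'(1_T)·1_{Tᶜ}`, `v_{T,z} = u'^{T∖z}·1_{Tᶜ}`) of a FLAT field and of (truncated) level-`N`
fields of `ψ'`. By the Jensen bound `K1lhs R ≤ Σ_k (‖R‖₁/‖r_k‖₁) K1lhs r_k` (mass fractions as
weights) and the Cauchy–Schwarz floors (`…PoAveragingFloors`: the flat components cost at most the
floor shift `≤ 1 + 2·slack`), the stub follows — with `C_A = C² + 4C + 2` — from two estimates on the
level-`N` ground vector, stated here as the hypotheses `hT₂, hT₁` (TILT: the level-`N` flatness
inequalities continue to hold, up to `1 + C·slack`, when background `T'` and added particle `z` are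
reweighted by the PO mass ratio `‖r^{T'∪z}[Φ]‖₁/‖w‖₁` and the field is truncated at `z`) and
`hP₂, hP₁` (PARALLELISM: the mass-weighted `ω`-weights of the components exceed the `ω`-weight of the
mixture by at most `1 + C·slack` — a variance of the normalised component profiles). These four
inequalities are the precise research content ("BET") of `stub_poAveraging`; everything else is here.
ED (pure-python Lanczos-free power iteration, tori `3³` with `N = 2…6` and `4³` with `N = 2, 3`):
parallelism excess `(0.10–0.24)/L³`, Jensen loss `(0.24–0.58)/L³`, tilt beyond the truncation floor
shift `1/(L³-N)` at most `5·10⁻⁴`; the whole route loses `≤ 0.55·slack` per level at these sizes.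

`cb2po_assemble` (real arithmetic of the four estimates), `cb2po_K1lhs_mixture_le₂` (Jensen for
`a + b + Σ_{k∈s} r_k`), `stub_poAveragingReduction` (the registered reduction; the stub's two-particle
hypothesis is not needed for it, the one-particle one only through the floor `2L³ ≤ (L³-N+1)·M₁`). -/

noncomputable section

open scoped BigOperators ComplexOrder
open Literature.MathematicalPhysics.QuantumLattice Literature.Probability.LatticeModels Matrix Finset
open Summit.AtomisticToContinuum.BoseEinsteinCondensation.Theses.BECStronglyRayleigh
open Summit.AtomisticToContinuum.BoseEinsteinCondensation.Theorems.InsertionFieldDelocalisation.Negative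

namespace Summit.AtomisticToContinuum.BoseEinsteinCondensation.Cruxes.InsertionFieldDelocalisation.CoshBudgetPenroseOnsager

/-- **Assembly arithmetic.** From `A ≤ F + X` (Jensen), `F ≤ M̂(1+2s)·FP` (flat components at the
floor), `X ≤ M̂(1+Cs)·XP` (tilt), `FP + XP ≤ (1+Cs)·K` (parallelism), with `M̂, C, FP, XP, K ≥ 0` and
`0 ≤ s ≤ 1`: `A ≤ M̂(1 + (C²+4C+2)s)·K`. [folklore] -/
theorem cb2po_assemble {A F X FP XP K Mh C s : ℝ} (hA : A ≤ F + X) (hF : F ≤ Mh * (1 + 2 * s) * FP)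
    (hX : X ≤ Mh * (1 + C * s) * XP) (hP : FP + XP ≤ (1 + C * s) * K) (hMh : 0 ≤ Mh) (hC : 0 ≤ C)
    (hs0 : 0 ≤ s) (hs1 : s ≤ 1) (hFP : 0 ≤ FP) (hXP : 0 ≤ XP) (hK : 0 ≤ K) :
    A ≤ Mh * (1 + (C ^ 2 + 4 * C + 2) * s) * K := by
  have h1 : F + X ≤ Mh * (1 + (C + 2) * s) * (FP + XP) := by
    have hF' : Mh * (1 + 2 * s) * FP ≤ Mh * (1 + (C + 2) * s) * FP :=
      mul_le_mul_of_nonneg_right (mul_le_mul_of_nonneg_left (by nlinarith) hMh) hFP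
    have hX' : Mh * (1 + C * s) * XP ≤ Mh * (1 + (C + 2) * s) * XP :=
      mul_le_mul_of_nonneg_right (mul_le_mul_of_nonneg_left (by nlinarith) hMh) hXP
    linarith
  have h2 : Mh * (1 + (C + 2) * s) * (FP + XP) ≤ Mh * (1 + (C + 2) * s) * ((1 + C * s) * K) :=
    mul_le_mul_of_nonneg_left hP (mul_nonneg hMh (by positivity))
  have h3 : (1 + (C + 2) * s) * (1 + C * s) ≤ 1 + (C ^ 2 + 4 * C + 2) * s := by
    nlinarith [mul_le_of_le_one_right (mul_nonneg (by positivity : (0 : ℝ) ≤ C ^ 2 + 2 * C) hs0) hs1]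
  calc A ≤ F + X := hA
    _ ≤ Mh * (1 + (C + 2) * s) * ((1 + C * s) * K) := h1.trans h2
    _ = Mh * ((1 + (C + 2) * s) * (1 + C * s)) * K := by ring
    _ ≤ Mh * (1 + (C ^ 2 + 4 * C + 2) * s) * K :=
        mul_le_mul_of_nonneg_right (mul_le_mul_of_nonneg_left h3 hMh) hK

section Jensen

variable {ι κ : Type*} [Fintype ι] [DecidableEq κ]

/-- The Jensen bound `cb2po_K1lhs_mixture_le` for a mixture `R = a + b + Σ_{k ∈ s} r_k` of nonnegative
fields: `K1lhs R ≤ (S/‖a‖₁) K1lhs a + (S/‖b‖₁) K1lhs b + Σ_k (S/‖r_k‖₁) K1lhs r_k`, `S = ‖R‖₁`.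
[folklore] -/
theorem cb2po_K1lhs_mixture_le₂ (s : Finset κ) (a b : ι → ℝ) (r : κ → ι → ℝ) (ha : ∀ x, 0 ≤ a x)
    (hb : ∀ x, 0 ≤ b x) (hr : ∀ k ∈ s, ∀ x, 0 ≤ r k x) (R : ι → ℝ)
    (hR : ∀ x, R x = a x + b x + ∑ k ∈ s, r k x) :
    K1lhs R ≤ (∑ x, R x) / (∑ x, a x) * K1lhs a + (∑ x, R x) / (∑ x, b x) * K1lhs b +
      ∑ k ∈ s, (∑ x, R x) / (∑ x, r k x) * K1lhs (r k) := by
  let emb : κ ↪ Option (Option κ) :=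
    ⟨fun k => some (some k), fun k k' h => Option.some_injective _ (Option.some_injective _ h)⟩
  let r' : Option (Option κ) → ι → ℝ := fun k => k.elim a fun k' => k'.elim b r
  have h1 : some none ∉ s.map emb := by simp [emb]
  have h2 : none ∉ insert (some none) (s.map emb) := by simp [emb]
  have hr' : ∀ k ∈ insert none (insert (some none) (s.map emb)), ∀ x, 0 ≤ r' k x := by
    intro k hk x
    simp only [Finset.mem_insert, Finset.mem_map] at hk
    rcases hk with rfl | rfl | ⟨k', hk', rfl⟩
    · exact ha x
    · exact hb x
    · exact hr k' hk' x
  have hR' : ∀ x, R x = ∑ k ∈ insert none (insert (some none) (s.map emb)), r' k x := by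
    intro x
    rw [Finset.sum_insert h2, Finset.sum_insert h1, Finset.sum_map, ← add_assoc]
    exact hR x
  have h := cb2po_K1lhs_mixture_le _ r' hr' R hR'
  rw [Finset.sum_insert h2, Finset.sum_insert h1, Finset.sum_map, ← add_assoc] at h
  exact h

end Jensen

section Reduction

/-- **Registered sub-goal `stub_poAveragingReduction`: `stub_poAveraging` reduced to tilt +
parallelism (PO averaging, card (B4)).** For an admissible level-`N` datum `ψ'` (`L ≥ 3`, `2 ≤ N`,
`2(N+1) ≤ L³`), any real `M` and the one-particle inequality with constant `M₁`, IF the level-`N` fields of `ψ'` reweighted by the PO mass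
ratios and truncated at the added particle are still flat with constant `max M M₁·(1 + C·slack)`
(3rd hypothesis, `hT₂` in the proof: the `g`- and `w`-components at the two-particle backgrounds
`|T| = N-1`; 5th, `hT₁`: the `v`-components at `|T| = N`) AND the mass-weighted `ω`-weights of the
components exceed the `ω`-weight of the PO mixture by at most `1 + C·slack` (4th and 6th hypotheses,
`hP₂`, `hP₁`), THEN both insertion-field
inequalities hold for the PO vector `Φ = A†ψ'` at level `N + 1` with constant
`max M M₁·(1 + (C²+4C+2)·slack)`, `slack = 1/(N+1)² + 1/√((N+1)L³)` — i.e. the registered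
`stub_poAveraging` with `C_A = C² + 4C + 2`. (Decompositions `cb2po_field_poVec`/`cb2po_field1_poVec`,
Jensen `cb2po_K1lhs_mixture_le₂`, flat components at the floor `cb2po_K1lhs_flat` +
`cb2po_floor_le_const_one` (floor shift `≤ 1 + 2·slack` as `1/(L³-N) ≤ 2/L³ ≤ 2·slack`), and
`cb2po_assemble`.) [folklore] -/
theorem stub_poAveragingReduction :
    ∀ (C : ℝ), 0 ≤ C → ∀ (L : ℕ) [NeZero L], 3 ≤ L → ∀ N : ℕ, 2 ≤ N → 2 * (N + 1) ≤ L ^ 3 →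
    ∀ (M M₁ : ℝ) (ψ' : TensorIndex (TorusSite 3 L) 2 → ℂ),
    let Φ : TensorIndex (TorusSite 3 L) 2 → ℂ := fun σ => ∑ x, if σ x = 0 then ψ' (Function.update σ x 1) else 0;
    let s : ℝ := 1 / ((N + 1 : ℕ) : ℝ) ^ 2 + 1 / Real.sqrt (((N + 1 : ℕ) : ℝ) * (L : ℝ) ^ 3);
    let u : Finset (TorusSite 3 L) → TorusSite 3 L → ℝ :=
      fun T x => if x ∉ T then (ψ' (fun z => if z ∈ insert x T then 0 else 1)).re else 0;
    let uΦ : Finset (TorusSite 3 L) → TorusSite 3 L → ℝ :=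
      fun T x => if x ∉ T then (Φ (fun z => if z ∈ insert x T then 0 else 1)).re else 0;
    let f : Finset (TorusSite 3 L) → TorusSite 3 L → ℝ := fun T x => if x ∉ T then ∑ y, u T y else 0;
    let g : Finset (TorusSite 3 L) → TorusSite 3 L → ℝ := fun T x => ((L : ℝ) ^ 3 - 2 * N) * u T x;
    let w : Finset (TorusSite 3 L) → TorusSite 3 L → TorusSite 3 L → ℝ :=
      fun T z x => if x ∉ T then field ψ' (T.erase z) x else 0;
    let c : Finset (TorusSite 3 L) → TorusSite 3 L → ℝ :=
      fun T x => if x ∉ T then (ψ' (fun z => if z ∈ T then 0 else 1)).re else 0;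
    let v : Finset (TorusSite 3 L) → TorusSite 3 L → TorusSite 3 L → ℝ :=
      fun T z x => if x ∉ T then u (T.erase z) x else 0;
    let S₂ : Finset (TorusSite 3 L) → ℝ := fun T => ∑ x, field Φ T x;
    let S₁ : Finset (TorusSite 3 L) → ℝ := fun T => ∑ x, uΦ T x;
    (ψ' ∈ spinZSector 1 (((N : ℕ) : ℝ) - (L : ℝ) ^ 3 / 2) ∧ ψ' ≠ 0 ∧
      (xyTorus 3 L 1).mulVec ψ' =
        ((lowestEnergyInSector 1 (xyTorus 3 L 1) (((N : ℕ) : ℝ) - (L : ℝ) ^ 3 / 2) : ℝ) : ℂ) • ψ' ∧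
      ∀ σ, 0 ≤ (ψ' σ).re ∧ (ψ' σ).im = 0) →
    ((L : ℝ) ^ 3 * ∑ T ∈ (univ : Finset (TorusSite 3 L)).powersetCard (N - 1), K1lhs (u T) ≤ M₁ * ∑ T ∈ (univ : Finset (TorusSite 3 L)).powersetCard (N - 1), K1rhs (u T)) →
    ((L : ℝ) ^ 3 * ∑ T ∈ (univ : Finset (TorusSite 3 L)).powersetCard (N - 1),
        (S₂ T / (∑ x, g T x) * K1lhs (g T) + ∑ z ∈ T, S₂ T / (∑ x, w T z x) * K1lhs (w T z)) ≤
      max M M₁ * (1 + C * s) * ∑ T ∈ (univ : Finset (TorusSite 3 L)).powersetCard (N - 1),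
        (S₂ T / (∑ x, g T x) * K1rhs (g T) + ∑ z ∈ T, S₂ T / (∑ x, w T z x) * K1rhs (w T z))) →
    (∑ T ∈ (univ : Finset (TorusSite 3 L)).powersetCard (N - 1), (S₂ T / (∑ x, f T x) * K1rhs (f T) + S₂ T / (∑ x, g T x) * K1rhs (g T) +
        ∑ z ∈ T, S₂ T / (∑ x, w T z x) * K1rhs (w T z)) ≤
      (1 + C * s) * ∑ T ∈ (univ : Finset (TorusSite 3 L)).powersetCard (N - 1), K1rhs (field Φ T)) →
    ((L : ℝ) ^ 3 * ∑ T ∈ (univ : Finset (TorusSite 3 L)).powersetCard N, ∑ z ∈ T, S₁ T / (∑ x, v T z x) * K1lhs (v T z) ≤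
      max M M₁ * (1 + C * s) * ∑ T ∈ (univ : Finset (TorusSite 3 L)).powersetCard N, ∑ z ∈ T, S₁ T / (∑ x, v T z x) * K1rhs (v T z)) →
    (∑ T ∈ (univ : Finset (TorusSite 3 L)).powersetCard N, (S₁ T / (∑ x, c T x) * K1rhs (c T) + ∑ z ∈ T, S₁ T / (∑ x, v T z x) * K1rhs (v T z)) ≤
      (1 + C * s) * ∑ T ∈ (univ : Finset (TorusSite 3 L)).powersetCard N, K1rhs (uΦ T)) →
    K1Ineq (max M M₁ * (1 + (C ^ 2 + 4 * C + 2) * s)) L (N + 1) Φ ∧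
    ((L : ℝ) ^ 3 * ∑ T ∈ (univ : Finset (TorusSite 3 L)).powersetCard (N + 1 - 1), K1lhs (uΦ T) ≤
      max M M₁ * (1 + (C ^ 2 + 4 * C + 2) * s) *
        ∑ T ∈ (univ : Finset (TorusSite 3 L)).powersetCard (N + 1 - 1), K1rhs (uΦ T)) := by
  intro C hC L _ hL N hN hNL M M₁ ψ' Φ s u uΦ f g w c v S₂ S₁ hψ' hK₁ hT₂ hP₂ hT₁ hP₁
  obtain ⟨hsec, hne, -, hnn⟩ := hψ'
  have hΦ : ∀ σ, Φ σ = ∑ x, if σ x = 0 then ψ' (Function.update σ x 1) else 0 := fun σ => rfl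
  set V : ℝ := (L : ℝ) ^ 3 with hVdef
  set Mh : ℝ := max M M₁ with hMhdef
  have hL0 : (0 : ℝ) < L := by exact_mod_cast (show 0 < L by omega)
  have hV0 : 0 < V := pow_pos hL0 3
  have hNV : 2 * ((N : ℝ) + 1) ≤ V := by rw [hVdef]; exact_mod_cast hNL
  have hN1 : (1 : ℝ) ≤ N := by exact_mod_cast (show 1 ≤ N by omega)
  have hs0 : 0 ≤ s := by
    show (0 : ℝ) ≤ 1 / ((N + 1 : ℕ) : ℝ) ^ 2 + 1 / Real.sqrt (((N + 1 : ℕ) : ℝ) * V)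
    positivity
  have hsV : 1 / V ≤ s := by
    have hsq : Real.sqrt (((N + 1 : ℕ) : ℝ) * V) ≤ V := by
      rw [Real.sqrt_le_left hV0.le]
      push_cast
      nlinarith only [hNV, hV0]
    have h1 : 1 / V ≤ 1 / Real.sqrt (((N + 1 : ℕ) : ℝ) * V) :=
      one_div_le_one_div_of_le (Real.sqrt_pos.2 (by push_cast; positivity)) hsq
    have h2 : (0 : ℝ) ≤ 1 / ((N + 1 : ℕ) : ℝ) ^ 2 := by positivity
    show 1 / V ≤ 1 / ((N + 1 : ℕ) : ℝ) ^ 2 + 1 / Real.sqrt (((N + 1 : ℕ) : ℝ) * V)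
    linarith only [h1, h2]
  have hs1 : s ≤ 1 := by
    have h1 : 1 / ((N + 1 : ℕ) : ℝ) ^ 2 ≤ 1 / 2 := by
      rw [div_le_div_iff₀ (by positivity) (by norm_num)]
      push_cast
      nlinarith only [hN1]
    have h2 : 1 / Real.sqrt (((N + 1 : ℕ) : ℝ) * V) ≤ 1 / 2 := by
      rw [div_le_div_iff₀ (Real.sqrt_pos.2 (by push_cast; positivity)) (by norm_num), one_mul, one_mul]
      refine Real.le_sqrt_of_sq_le ?_
      push_cast
      nlinarith only [hN1, hNV]
    show 1 / ((N + 1 : ℕ) : ℝ) ^ 2 + 1 / Real.sqrt (((N + 1 : ℕ) : ℝ) * V) ≤ 1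
    linarith only [h1, h2]
  have hfl₁ : 2 * V ≤ (V - N + 1) * M₁ :=
    cb2po_floor_le_const_one (by omega) (by omega) hsec hne hnn hK₁
  have hM₁ : 0 < M₁ := by
    by_contra h
    push Not at h
    have : (V - N + 1) * M₁ ≤ 0 := mul_nonpos_of_nonneg_of_nonpos (by linarith only [hNV, hN1]) h
    linarith only [this, hfl₁, hV0]
  have hMh1 : M₁ ≤ Mh := le_max_right M M₁
  have hMh0 : 0 ≤ Mh := hM₁.le.trans hMh1
  -- nonnegativity of all amplitudes, fields and components
  have hnn1 : ∀ σ, 0 ≤ (ψ' σ).re := fun σ => (hnn σ).1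
  have hΦnn : ∀ σ, 0 ≤ (Φ σ).re := fun σ => (cb2po_poVec_nonneg ψ' Φ hΦ hnn σ).1
  have hite : ∀ (p : Prop) [Decidable p] (a : ℝ), 0 ≤ a → 0 ≤ (if p then a else 0) := by
    intro p _ a ha
    split_ifs
    · exact ha
    · exact le_rfl
  have hu0 : ∀ (T : Finset (TorusSite 3 L)) (x : TorusSite 3 L), 0 ≤ u T x :=
    fun T x => hite _ _ (hnn1 _)
  have hF0 : ∀ (T : Finset (TorusSite 3 L)) (x : TorusSite 3 L), 0 ≤ f T x :=
    fun T x => hite _ _ (Finset.sum_nonneg fun y _ => hu0 T y)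
  have hV2N : (0 : ℝ) ≤ V - 2 * N := by linarith only [hNV]
  have hG0 : ∀ (T : Finset (TorusSite 3 L)) (x : TorusSite 3 L), 0 ≤ g T x :=
    fun T x => mul_nonneg hV2N (hu0 T x)
  have hW0 : ∀ (T : Finset (TorusSite 3 L)) (z x : TorusSite 3 L), 0 ≤ w T z x :=
    fun T z x => hite _ _ (field_nonneg ψ' hnn1 _ _)
  have hS20 : ∀ T : Finset (TorusSite 3 L), 0 ≤ S₂ T := fun T =>
    Finset.sum_nonneg fun x _ => field_nonneg Φ hΦnn T x
  have hC0 : ∀ (T : Finset (TorusSite 3 L)) (x : TorusSite 3 L), 0 ≤ c T x :=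
    fun T x => hite _ _ (hnn1 _)
  have hV10 : ∀ (T : Finset (TorusSite 3 L)) (z x : TorusSite 3 L), 0 ≤ v T z x :=
    fun T z x => hite _ _ (hu0 _ _)
  have huΦ0 : ∀ (T : Finset (TorusSite 3 L)) (x : TorusSite 3 L), 0 ≤ uΦ T x :=
    fun T x => hite _ _ (hΦnn _)
  have hS10 : ∀ T : Finset (TorusSite 3 L), 0 ≤ S₁ T := fun T =>
    Finset.sum_nonneg fun x _ => huΦ0 T x
  have hrhs0 : ∀ r : TorusSite 3 L → ℝ, 0 ≤ K1rhs r := fun r => Finset.sum_nonneg fun x _ => sq_nonneg _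
  have hfilter : ∀ T : Finset (TorusSite 3 L), (univ.filter fun x => x ∉ T) = Tᶜ := fun T => by
    ext x
    simp
  have hcardc : ∀ T : Finset (TorusSite 3 L), ((univ.filter fun x => x ∉ T).card : ℝ) = V - T.card :=
    fun T => by
    rw [hfilter, Finset.card_compl, card_torusSite 3 L, Nat.cast_sub, Nat.cast_pow]
    rw [← card_torusSite 3 L]
    exact Finset.card_le_univ T
  have hcardpos : ∀ T : Finset (TorusSite 3 L), T.card ≤ N → 0 < (univ.filter fun x => x ∉ T).card :=
    fun T hT => by
    have h : (0 : ℝ) < ((univ.filter fun x => x ∉ T).card : ℝ) := by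
      rw [hcardc]
      have : (T.card : ℝ) ≤ N := by exact_mod_cast hT
      linarith only [this, hNV]
    exact_mod_cast h
  refine ⟨?_, ?_⟩
  · -- two-particle part
    rw [K1Ineq, show N + 1 - 2 = N - 1 by omega]
    have hJ : ∀ T ∈ (univ : Finset (TorusSite 3 L)).powersetCard (N - 1), K1lhs (field Φ T) ≤
        S₂ T / (∑ x, f T x) * K1lhs (f T) + S₂ T / (∑ x, g T x) * K1lhs (g T) +
          ∑ z ∈ T, S₂ T / (∑ x, w T z x) * K1lhs (w T z) := by
      intro T hT
      have hTcard : T.card = N - 1 := (Finset.mem_powersetCard.1 hT).2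
      have h := cb2po_K1lhs_mixture_le₂ T (f T) (g T) (fun z => w T z) (hF0 T) (hG0 T)
        (fun z _ x => hW0 T z x) (field Φ T) (fun x => by
          by_cases hx : x ∈ T
          · show field Φ T x = (if x ∉ T then (∑ y, (if y ∉ T then (ψ' (fun z => if z ∈ insert y T then 0 else 1)).re else 0)) else 0) +
              ((L : ℝ) ^ 3 - 2 * N) * (if x ∉ T then (ψ' (fun z => if z ∈ insert x T then 0 else 1)).re else 0) + ∑ z ∈ T, (if x ∉ T then field ψ' (T.erase z) x else 0)
            rw [field_eq_zero_of_mem Φ T hx]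
            simp [hx]
          · show field Φ T x = (if x ∉ T then (∑ y, (if y ∉ T then (ψ' (fun z => if z ∈ insert y T then 0 else 1)).re else 0)) else 0) +
              ((L : ℝ) ^ 3 - 2 * N) * (if x ∉ T then (ψ' (fun z => if z ∈ insert x T then 0 else 1)).re else 0) + ∑ z ∈ T, (if x ∉ T then field ψ' (T.erase z) x else 0)
            rw [cb2po_field_poVec ψ' Φ hΦ T hx, if_pos hx, if_pos hx, card_torusSite 3 L, hTcard,
              Nat.cast_sub (show 1 ≤ N by omega)]
            rw [Finset.sum_congr rfl fun z _ => if_pos hx]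
            push_cast
            ring)
      beta_reduce at h
      exact h
    have hflat : ∀ T ∈ (univ : Finset (TorusSite 3 L)).powersetCard (N - 1), V * (S₂ T / (∑ x, f T x) * K1lhs (f T)) ≤
        Mh * (1 + 2 * s) * (S₂ T / (∑ x, f T x) * K1rhs (f T)) := by
      intro T hT
      have hTcard : T.card = N - 1 := (Finset.mem_powersetCard.1 hT).2
      have hw : 0 ≤ S₂ T / (∑ x, f T x) := div_nonneg (hS20 T) (Finset.sum_nonneg fun x _ => hF0 T x)
      have hkey : V * K1lhs (f T) ≤ Mh * (1 + 2 * s) * K1rhs (f T) := by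
        show V * K1lhs (fun x => if x ∉ T then (∑ y, (if y ∉ T then (ψ' (fun z => if z ∈ insert y T then 0 else 1)).re else 0)) else 0) ≤
          Mh * (1 + 2 * s) * K1rhs (fun x => if x ∉ T then (∑ y, (if y ∉ T then (ψ' (fun z => if z ∈ insert y T then 0 else 1)).re else 0)) else 0)
        rw [cb2po_K1lhs_flat (fun x => x ∉ T) (hcardpos T (by omega)), cb2po_K1rhs_flat (fun x => x ∉ T),
          hcardc T, hTcard, Nat.cast_sub (show 1 ≤ N by omega), Nat.cast_one]
        have hc2 : (0 : ℝ) ≤ (∑ y, (if y ∉ T then (ψ' (fun z => if z ∈ insert y T then 0 else 1)).re else 0)) ^ 2 := sq_nonneg _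
        have hVN : (0 : ℝ) ≤ V - ((N : ℝ) - 1) := by linarith only [hNV, hN1]
        have h1 : V * (2 * (∑ y, (if y ∉ T then (ψ' (fun z => if z ∈ insert y T then 0 else 1)).re else 0)) ^ 2) ≤ M₁ * ((V - ((N : ℝ) - 1)) * (∑ y, (if y ∉ T then (ψ' (fun z => if z ∈ insert y T then 0 else 1)).re else 0)) ^ 2) := by
          have := mul_le_mul_of_nonneg_right hfl₁ hc2
          linarith only [this]
        have h2 : M₁ ≤ Mh * (1 + 2 * s) := by
          have : Mh ≤ Mh * (1 + 2 * s) := le_mul_of_one_le_right hMh0 (by linarith only [hs0])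
          linarith only [hMh1, this]
        exact h1.trans (mul_le_mul_of_nonneg_right h2 (mul_nonneg hVN hc2))
      calc V * (S₂ T / (∑ x, f T x) * K1lhs (f T)) = S₂ T / (∑ x, f T x) * (V * K1lhs (f T)) := by ring
        _ ≤ S₂ T / (∑ x, f T x) * (Mh * (1 + 2 * s) * K1rhs (f T)) := mul_le_mul_of_nonneg_left hkey hw
        _ = Mh * (1 + 2 * s) * (S₂ T / (∑ x, f T x) * K1rhs (f T)) := by ring
    refine cb2po_assemble (F := V * ∑ T ∈ (univ : Finset (TorusSite 3 L)).powersetCard (N - 1), S₂ T / (∑ x, f T x) * K1lhs (f T))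
      (X := V * ∑ T ∈ (univ : Finset (TorusSite 3 L)).powersetCard (N - 1),
        (S₂ T / (∑ x, g T x) * K1lhs (g T) + ∑ z ∈ T, S₂ T / (∑ x, w T z x) * K1lhs (w T z)))
      (FP := ∑ T ∈ (univ : Finset (TorusSite 3 L)).powersetCard (N - 1), S₂ T / (∑ x, f T x) * K1rhs (f T))
      (XP := ∑ T ∈ (univ : Finset (TorusSite 3 L)).powersetCard (N - 1),
        (S₂ T / (∑ x, g T x) * K1rhs (g T) + ∑ z ∈ T, S₂ T / (∑ x, w T z x) * K1rhs (w T z)))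
      ?_ ?_ hT₂ ?_ hMh0 hC hs0 hs1 ?_ ?_ ?_
    · -- Jensen, summed
      rw [← mul_add, ← Finset.sum_add_distrib]
      refine mul_le_mul_of_nonneg_left (Finset.sum_le_sum fun T hT => ?_) hV0.le
      rw [← add_assoc]
      exact hJ T hT
    · -- flat components
      rw [Finset.mul_sum, Finset.mul_sum]
      exact Finset.sum_le_sum hflat
    · -- parallelism
      rw [← Finset.sum_add_distrib]
      refine le_of_eq_of_le (Finset.sum_congr rfl fun T _ => ?_) hP₂
      rw [add_assoc]
    · exact Finset.sum_nonneg fun T _ => mul_nonneg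
        (div_nonneg (hS20 T) (Finset.sum_nonneg fun x _ => hF0 T x)) (hrhs0 _)
    · exact Finset.sum_nonneg fun T _ => add_nonneg
        (mul_nonneg (div_nonneg (hS20 T) (Finset.sum_nonneg fun x _ => hG0 T x)) (hrhs0 _))
        (Finset.sum_nonneg fun z _ => mul_nonneg
          (div_nonneg (hS20 T) (Finset.sum_nonneg fun x _ => hW0 T z x)) (hrhs0 _))
    · exact Finset.sum_nonneg fun T _ => hrhs0 _
  · -- one-particle part
    rw [show N + 1 - 1 = N by omega]
    have hJ : ∀ T ∈ (univ : Finset (TorusSite 3 L)).powersetCard N, K1lhs (uΦ T) ≤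
        S₁ T / (∑ x, c T x) * K1lhs (c T) +
          S₁ T / (∑ _x : TorusSite 3 L, (0 : ℝ)) * K1lhs (fun _ : TorusSite 3 L => (0 : ℝ)) +
          ∑ z ∈ T, S₁ T / (∑ x, v T z x) * K1lhs (v T z) := by
      intro T hT
      have h := cb2po_K1lhs_mixture_le₂ T (c T) (fun _ => (0 : ℝ)) (fun z => v T z) (hC0 T)
        (fun x => le_rfl) (fun z _ x => hV10 T z x) (uΦ T) (fun x => by
          by_cases hx : x ∈ T
          · show (if x ∉ T then (Φ (fun z => if z ∈ insert x T then 0 else 1)).re else 0) =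
              (if x ∉ T then ((ψ') (fun z => if z ∈ T then 0 else 1)).re else 0) + 0 +
              ∑ z ∈ T, (if x ∉ T then (if x ∉ T.erase z then
                (ψ' (fun w => if w ∈ insert x (T.erase z) then 0 else 1)).re else 0) else 0)
            simp [hx]
          · show (if x ∉ T then (Φ (fun z => if z ∈ insert x T then 0 else 1)).re else 0) =
              (if x ∉ T then ((ψ') (fun z => if z ∈ T then 0 else 1)).re else 0) + 0 +
              ∑ z ∈ T, (if x ∉ T then (if x ∉ T.erase z then
                (ψ' (fun w => if w ∈ insert x (T.erase z) then 0 else 1)).re else 0) else 0)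
            rw [if_pos hx, if_pos hx, cb2po_field1_poVec ψ' Φ hΦ T hx, add_zero]
            rw [Finset.sum_congr rfl fun z _ => if_pos hx])
      beta_reduce at h
      exact h
    have hflat : ∀ T ∈ (univ : Finset (TorusSite 3 L)).powersetCard N, V * (S₁ T / (∑ x, c T x) * K1lhs (c T)) ≤
        Mh * (1 + 2 * s) * (S₁ T / (∑ x, c T x) * K1rhs (c T)) := by
      intro T hT
      have hTcard : T.card = N := (Finset.mem_powersetCard.1 hT).2
      have hw : 0 ≤ S₁ T / (∑ x, c T x) := div_nonneg (hS10 T) (Finset.sum_nonneg fun x _ => hC0 T x)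
      have hkey : V * K1lhs (c T) ≤ Mh * (1 + 2 * s) * K1rhs (c T) := by
        show V * K1lhs (fun x => if x ∉ T then ((ψ') (fun z => if z ∈ T then 0 else 1)).re else 0) ≤
          Mh * (1 + 2 * s) * K1rhs (fun x => if x ∉ T then ((ψ') (fun z => if z ∈ T then 0 else 1)).re else 0)
        rw [cb2po_K1lhs_flat (fun x => x ∉ T) (hcardpos T (by omega)), cb2po_K1rhs_flat (fun x => x ∉ T),
          hcardc T, hTcard]
        have hc2 : (0 : ℝ) ≤ ((ψ') (fun z => if z ∈ T then 0 else 1)).re ^ 2 := sq_nonneg _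
        -- `2V ≤ (V-N+1) M₁ ≤ (1+2s)(V-N) M₁` since `2s(V-N) ≥ 2(1/V)(V/2) = 1`
        have hsVN : 1 ≤ 2 * s * (V - N) := by
          have h1 : V / 2 ≤ V - N := by linarith only [hNV]
          have h2 : 1 / V * (V / 2) ≤ s * (V - N) :=
            mul_le_mul hsV h1 (by linarith only [hV0]) hs0
          have h3 : 1 / V * (V / 2) = 1 / 2 := by field_simp
          linarith only [h2, h3]
        have hVN : (0 : ℝ) ≤ V - N := by linarith only [hNV]
        have h1 : V * (2 * ((ψ') (fun z => if z ∈ T then 0 else 1)).re ^ 2) ≤ M₁ * ((V - N + 1) * ((ψ') (fun z => if z ∈ T then 0 else 1)).re ^ 2) := by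
          have := mul_le_mul_of_nonneg_right hfl₁ hc2
          linarith only [this]
        have h2 : M₁ * ((V - N + 1) * ((ψ') (fun z => if z ∈ T then 0 else 1)).re ^ 2) ≤ M₁ * ((1 + 2 * s) * (V - N) * ((ψ') (fun z => if z ∈ T then 0 else 1)).re ^ 2) :=
          mul_le_mul_of_nonneg_left (mul_le_mul_of_nonneg_right (by linarith only [hsVN]) hc2) hM₁.le
        have h3 : M₁ * ((1 + 2 * s) * (V - N) * ((ψ') (fun z => if z ∈ T then 0 else 1)).re ^ 2) ≤
            Mh * ((1 + 2 * s) * (V - N) * ((ψ') (fun z => if z ∈ T then 0 else 1)).re ^ 2) :=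
          mul_le_mul_of_nonneg_right hMh1
            (mul_nonneg (mul_nonneg (by linarith only [hs0]) hVN) hc2)
        calc V * (2 * ((ψ') (fun z => if z ∈ T then 0 else 1)).re ^ 2) ≤ Mh * ((1 + 2 * s) * (V - N) * ((ψ') (fun z => if z ∈ T then 0 else 1)).re ^ 2) := h1.trans (h2.trans h3)
          _ = Mh * (1 + 2 * s) * ((V - (N : ℝ)) * ((ψ') (fun z => if z ∈ T then 0 else 1)).re ^ 2) := by ring
      calc V * (S₁ T / (∑ x, c T x) * K1lhs (c T)) = S₁ T / (∑ x, c T x) * (V * K1lhs (c T)) := by ring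
        _ ≤ S₁ T / (∑ x, c T x) * (Mh * (1 + 2 * s) * K1rhs (c T)) := mul_le_mul_of_nonneg_left hkey hw
        _ = Mh * (1 + 2 * s) * (S₁ T / (∑ x, c T x) * K1rhs (c T)) := by ring
    have hzero : ∀ T : Finset (TorusSite 3 L),
        S₁ T / (∑ _x : TorusSite 3 L, (0 : ℝ)) * K1lhs (fun _ : TorusSite 3 L => (0 : ℝ)) = 0 :=
      fun T => by
      simp [K1lhs]
    refine cb2po_assemble (F := V * ∑ T ∈ (univ : Finset (TorusSite 3 L)).powersetCard N, S₁ T / (∑ x, c T x) * K1lhs (c T))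
      (X := V * ∑ T ∈ (univ : Finset (TorusSite 3 L)).powersetCard N, ∑ z ∈ T, S₁ T / (∑ x, v T z x) * K1lhs (v T z))
      (FP := ∑ T ∈ (univ : Finset (TorusSite 3 L)).powersetCard N, S₁ T / (∑ x, c T x) * K1rhs (c T))
      (XP := ∑ T ∈ (univ : Finset (TorusSite 3 L)).powersetCard N, ∑ z ∈ T, S₁ T / (∑ x, v T z x) * K1rhs (v T z))
      ?_ ?_ hT₁ ?_ hMh0 hC hs0 hs1 ?_ ?_ ?_
    · rw [← mul_add, ← Finset.sum_add_distrib]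
      refine mul_le_mul_of_nonneg_left (Finset.sum_le_sum fun T hT => ?_) hV0.le
      have h := hJ T hT
      rw [hzero T, add_zero] at h
      exact h
    · rw [Finset.mul_sum, Finset.mul_sum]
      exact Finset.sum_le_sum hflat
    · rw [← Finset.sum_add_distrib]
      exact hP₁
    · exact Finset.sum_nonneg fun T _ => mul_nonneg
        (div_nonneg (hS10 T) (Finset.sum_nonneg fun x _ => hC0 T x)) (hrhs0 _)
    · exact Finset.sum_nonneg fun T _ => Finset.sum_nonneg fun z _ => mul_nonneg
        (div_nonneg (hS10 T) (Finset.sum_nonneg fun x _ => hV10 T z x)) (hrhs0 _)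
    · exact Finset.sum_nonneg fun T _ => hrhs0 _

end Reduction

end Summit.AtomisticToContinuum.BoseEinsteinCondensation.Cruxes.InsertionFieldDelocalisation.CoshBudgetPenroseOnsager

end
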